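import Mathlib
import HarnessLib.Audit
import Summits.PneNP.PneNP.Theorems.PstarCrossCaseT
import Summits.PneNP.PneNP.Theorems.PstarCrossCaseU2Touch
import Summits.PneNP.PneNP.Theorems.PstarGateCaseTOffQ

/-!
# The blind free CROSS gate, regime T (node N3): the rows of `q_m` against every real chord, the (EQ) chord, and the pin of `q_{(1,0)}` on the forcing set (O2 / E1; prover-1 g23)

FRONTIER range-avoidance ladder, rung F-N3 (`stmt-PneNP-19007`), cell `pnp-ideate`; restricted-model proof complexity — nothing here bears on `P` versus `NP`.

Node N3 (`PstarCrossNodes.CrossCaseT`): the real chords `E = (N.erase e_q).erase e_p` read along one `m ∈ {(0,1), (1,1)}`, all read, corner-forced.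
`PstarCrossCaseT.forcing_of_real` gives `Z(u_{e'}) ⊆ {u_p ∨ u_q = 1} ∩ Z(q_m)` for EVERY `e' ∈ E`, so the N4 toolkit (`PstarCrossProductAlgebra`,
`PstarCrossCaseU2Touch`) applies chord by chord:

* `caseT_row` — for every real chord `e'`, `q_m` is `0`, `u_{e'}`, or (up to adding `u_{e'}`) a NON-DEGENERATE product of two affine functions
  (`PstarCrossCaseU2Touch.clean_or_nondeg`);
* `caseT_eq_other` — **if `q_m = u_{e₁}` for a real chord `e₁` (the (EQ) chord), then every other real chord `e₂` has `u_{e₂} + u_{e₁}` a non-degenerate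
  product** (`u_{e₁}` vanishes on `Z(u_{e₂})`; `0`, `u_{e₂}` itself — `PstarChordBridgeForcing.chord_eq_of_EQ` — and a bare product are excluded by rank);
* `caseT_q10` — the first basis-changed coordinate is the old second one (`PstarGateCaseTOffQ.toX_fst_of_T`), so `PstarCrossCaseT.caseT_fst_cross` reads: **on the forcing set
  `{u_p = u_q = 0} ∪ {u_p ∨ u_q = 1, q_m = 1}` the second state-free part is pinned, `q_{(1,0)} = 1 + σ₂`**, `σ₂ = Σ_{e ∈ E} ((ρ_e)₂ + (ρ'_e)₂)`;
  `caseT_eq_q10` — in the (EQ) case `q_{(1,0)} + 1 + σ₂` therefore VANISHES on `Z(u_{e₁} + 1)`;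
* `classification_u_add_one`, `clean_or_nondeg_add_one`, `factors_fixed_off_D_add_one` — the toolkit against `u_{e₀} + 1` (same polar form, same rank),
  for that (EQ) endgame: `q_{(1,0)} + 1 + σ₂` is `0`, `u_{e₁} + 1`, or (up to `u_{e₁} + 1`) a non-degenerate product supported on the AND variables of `D e₁`.
-/

set_option linter.dupNamespace false -- `Summit.PneNP.PneNP.…`: summit = sub-problem name (D-0017 single-conjunct layout)

open Finset Module Literature.Computability.Complexity
open Summit.PneNP.PneNP.Theorems.PstarTyped (Typed)
open Summit.PneNP.PneNP.Theorems.PstarSALevel (varSet BoundaryExpanding SimpleOverlap)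
open Summit.PneNP.PneNP.Theorems.PstarCubeIdeals (IsAffineFn IsQuadFn)
open Summit.PneNP.PneNP.Theorems.PstarQuadRank (rad)
open Summit.PneNP.PneNP.Theorems.PstarProductRank (qform polar)
open Summit.PneNP.PneNP.Theorems.PstarReadSumset (V2)
open Summit.PneNP.PneNP.Theorems.PstarRankRigidityFour (classification)
open Summit.PneNP.PneNP.Theorems.PstarForcing (exists_ne_of_rank_four not_rank_four_of_mul)
open Summit.PneNP.PneNP.Theorems.PstarChordSystem (ChordSystem)
open Summit.PneNP.PneNP.Theorems.PstarChordSystemMap (mapSys toX mapSys_ρ mapSys_ρ' mapSys_F mapSys_t)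
open Summit.PneNP.PneNP.Theorems.PstarChordBridgeTools
open Summit.PneNP.PneNP.Theorems.PstarChordBridge
open Summit.PneNP.PneNP.Theorems.PstarChordBridgeForcing (gam sys_u_eq qform_add' rank_four_of_wf chord_eq_of_EQ)
open Summit.PneNP.PneNP.Theorems.PstarChordBridgeBasis (qDir polarDir)
open Summit.PneNP.PneNP.Theorems.PstarChordBridgeCorner (qDir_add)
open Summit.PneNP.PneNP.Theorems.PstarGateCaseTOffQ (toX_fst_of_T)
open Summit.PneNP.PneNP.Theorems.PstarCrossData (CrossData)
open Summit.PneNP.PneNP.Theorems.PstarCrossSystem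
open Summit.PneNP.PneNP.Theorems.PstarCrossCaseT (caseT_forced_cross caseT_fst_cross forcing_of_real)
open Summit.PneNP.PneNP.Theorems.PstarCrossCaseU2 (u_add)
open Summit.PneNP.PneNP.Theorems.PstarCrossProductAlgebra (mul_eq_zero_of_degenerate shift_of_vanish)
open Summit.PneNP.PneNP.Theorems.PstarCrossCaseU2Touch (card_J₀_le clean_or_nondeg u_add_single_of_unread)

namespace Summit.PneNP.PneNP.Theorems.PstarCrossCaseTRows

variable {n m : ℕ}

section

variable (I : LocalMap 4 n m) {r : ℕ} {B : BridgeData n m} {e_p e_q g₀ : Fin m}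

/-- `q_m` is quadratic with polar form `polarDir`. -/
theorem isQuadFn_qDir' (B : BridgeData n m) (mv : V2) : IsQuadFn (qDir I B mv) := ⟨polarDir I B mv, qDir_add I B mv⟩

/-- **CASE T rows.**  For every real chord `e'`, `q_m` is `0`, `u_{e'}`, or up to `u_{e'}` a non-degenerate product of two affine functions. -/
theorem caseT_row (hI : I.IsPure xorAndPred) (hT : Typed I) (hS : SimpleOverlap I) (hB : BoundaryExpanding r I) (hD : CrossData I r B e_p e_q g₀)
    {mv : V2} (hmvT : mv = (0, 1) ∨ mv = (1, 1))
    (hline : ∀ e ∈ (B.N.erase e_q).erase e_p,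
      (((sys I B).vsys e_p e_q).ρ e 0 = 0 ∨ ((sys I B).vsys e_p e_q).ρ e 0 = mv) ∧
      (((sys I B).vsys e_p e_q).ρ' e 0 = 0 ∨ ((sys I B).vsys e_p e_q).ρ' e 0 = mv))
    (hread : ∀ e ∈ (B.N.erase e_q).erase e_p, ((sys I B).vsys e_p e_q).ρ e 0 ≠ 0 ∨ ((sys I B).vsys e_p e_q).ρ' e 0 ≠ 0)
    {e' : Fin m} (he' : e' ∈ (B.N.erase e_q).erase e_p) :
    ((∀ x, qDir I B mv x = 0) ∨ (∀ x, qDir I B mv x = (sys I B).u e' x)) ∨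
    (∃ μ₁ μ₂ : (Fin n → ZMod 2) → ZMod 2, IsAffineFn μ₁ ∧ IsAffineFn μ₂ ∧
      (∃ z, μ₁ z ≠ μ₁ 0) ∧ (∃ z, μ₂ z ≠ μ₂ 0) ∧ (∃ z, μ₁ z + μ₁ 0 ≠ μ₂ z + μ₂ 0) ∧
      ((∀ x, qDir I B mv x = μ₁ x * μ₂ x) ∨ (∀ x, (sys I B).u e' x + qDir I B mv x = μ₁ x * μ₂ x))) :=
  clean_or_nondeg I hI hS hB hD (mem_of_mem_erase (mem_of_mem_erase he')) (isQuadFn_qDir' I B mv)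
    fun _ hx => (forcing_of_real I hI hT hD hmvT hline hread he' hx).2

/-- **The (EQ) chord is unique up to non-degenerate products.**  If `q_m = u_{e₁}` for a real chord `e₁`, then for every other real chord `e₂` the
sum `u_{e₂} + u_{e₁}` is a non-degenerate product of two affine functions. -/
theorem caseT_eq_other (hI : I.IsPure xorAndPred) (hT : Typed I) (hS : SimpleOverlap I) (hB : BoundaryExpanding r I)
    (hD : CrossData I r B e_p e_q g₀) {mv : V2} (hmvT : mv = (0, 1) ∨ mv = (1, 1))
    (hline : ∀ e ∈ (B.N.erase e_q).erase e_p,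
      (((sys I B).vsys e_p e_q).ρ e 0 = 0 ∨ ((sys I B).vsys e_p e_q).ρ e 0 = mv) ∧
      (((sys I B).vsys e_p e_q).ρ' e 0 = 0 ∨ ((sys I B).vsys e_p e_q).ρ' e 0 = mv))
    (hread : ∀ e ∈ (B.N.erase e_q).erase e_p, ((sys I B).vsys e_p e_q).ρ e 0 ≠ 0 ∨ ((sys I B).vsys e_p e_q).ρ' e 0 ≠ 0)
    {e₁ : Fin m} (he₁ : e₁ ∈ B.N) (hq : ∀ x, qDir I B mv x = (sys I B).u e₁ x)
    {e₂ : Fin m} (he₂ : e₂ ∈ (B.N.erase e_q).erase e_p) (hne : e₂ ≠ e₁) :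
    ∃ μ₁ μ₂ : (Fin n → ZMod 2) → ZMod 2, IsAffineFn μ₁ ∧ IsAffineFn μ₂ ∧
      (∃ z, μ₁ z ≠ μ₁ 0) ∧ (∃ z, μ₂ z ≠ μ₂ 0) ∧ (∃ z, μ₁ z + μ₁ 0 ≠ μ₂ z + μ₂ 0) ∧
      ∀ x, (sys I B).u e₂ x + (sys I B).u e₁ x = μ₁ x * μ₂ x := by
  have he₂N : e₂ ∈ B.N := mem_of_mem_erase (mem_of_mem_erase he₂)
  have hZ : ∀ x, (sys I B).u e₂ x = 0 → (sys I B).u e₁ x = 0 := fun x hx => by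
    rw [← hq x]; exact (forcing_of_real I hI hT hD hmvT hline hread he₂ hx).2
  have hg : IsQuadFn ((sys I B).u e₁) := ⟨polar (B.D e₁) (fun j => I.vars j 2) (fun j => I.vars j 3), u_add I B e₁⟩
  have hrank₁ := rank_four_of_wf I hI hS hB hD.wf (card_J₀_le I hD) he₁
  rcases clean_or_nondeg I hI hS hB hD he₂N hg hZ with (h0 | hu) | ⟨μ₁, μ₂, h₁, h₂, hn₁, hn₂, hn, hrow⟩
  · exfalso
    obtain ⟨v, hv⟩ := exists_ne_of_rank_four (u_add I B e₁) hrank₁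
    exact hv (by rw [h0 v, h0 0])
  · exfalso
    refine hne (chord_eq_of_EQ I hI hS hD.wf (q := qform (B.D e₁) (fun j => I.vars j 2) (fun j => I.vars j 3)) he₂N he₁
      (κ := gam B e₁ + gam B e₂) (κ' := 0) (fun x => ?_) (fun x => by rw [add_zero]))
    have h := hu x
    rw [sys_u_eq, sys_u_eq] at h
    have e : ∀ g₁ q₁ g₂ q₂ : ZMod 2, g₁ + q₁ = g₂ + q₂ → q₂ = q₁ + (g₁ + g₂) := by decide
    exact e _ _ _ _ h
  · rcases hrow with h | h
    · exfalso
      exact not_rank_four_of_mul (u_add I B e₁) h₁ h₂ (κ := 0) (fun x => by rw [add_zero]; exact h x) hrank₁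
    · exact ⟨μ₁, μ₂, h₁, h₂, hn₁, hn₂, hn, h⟩

/-! ## The pin of `q_{(1,0)}` on the forcing set -/

/-- **On the forcing set `q_{(1,0)} = 1 + σ₂`**, `σ₂ = Σ_{e ∈ E} ((ρ_e)₂ + (ρ'_e)₂)` the (constant) second-coordinate reads of the real chords. -/
theorem caseT_q10 (hI : I.IsPure xorAndPred) (hT : Typed I) (hD : CrossData I r B e_p e_q g₀) {mv : V2} (hmvT : mv = (0, 1) ∨ mv = (1, 1))
    (hline : ∀ e ∈ (B.N.erase e_q).erase e_p,
      (((sys I B).vsys e_p e_q).ρ e 0 = 0 ∨ ((sys I B).vsys e_p e_q).ρ e 0 = mv) ∧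
      (((sys I B).vsys e_p e_q).ρ' e 0 = 0 ∨ ((sys I B).vsys e_p e_q).ρ' e 0 = mv))
    (hread : ∀ e ∈ (B.N.erase e_q).erase e_p, ((sys I B).vsys e_p e_q).ρ e 0 ≠ 0 ∨ ((sys I B).vsys e_p e_q).ρ' e 0 ≠ 0)
    {x : Fin n → ZMod 2} (hx : (sys I B).orU e_p e_q x = 0 ∨ qDir I B mv x + (sys I B).orU e_p e_q x = 0) :
    qDir I B (1, 0) x = 1 + ∑ e ∈ (B.N.erase e_q).erase e_p, ((((sys I B).vsys e_p e_q).ρ e 0).2 + (((sys I B).vsys e_p e_q).ρ' e 0).2) := by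
  classical
  set V := (sys I B).vsys e_p e_q with hV
  have h := caseT_fst_cross I hI hT hD hmvT hline hx
  have hconst := vsys_const I hD
  have hpe : e_p ∈ B.N.erase e_q := mem_erase.2 ⟨hD.ne, hD.mem_p⟩
  -- rewrite the mapped coordinates as old second coordinates
  simp only [mapSys_F, mapSys_t, mapSys_ρ, mapSys_ρ', ← map_add, toX_fst_of_T hmvT] at h
  -- the summand of the virtual chord vanishes; the real chords are all ON
  have hterm_p : ((V.ρ e_p x + V.ρ' e_p x).2 : ZMod 2) = 0 := by
    rw [(vsys_reads_p I hD x).1, (vsys_reads_p I hD x).2]; rfl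
  have hON : ∀ e ∈ (B.N.erase e_q).erase e_p, ¬ V.u e x = 0 := fun e he h0 => by
    have h1 := caseT_forced_cross I hI hT hD hmvT hline hread hx e he
    rw [hV, ChordSystem.vsys_u_of_ne _ _ _ (ne_of_mem_erase he)] at h0
    rw [h0] at h1
    exact zero_ne_one h1
  have hsum : ∑ i ∈ (B.N.erase e_q).filter (fun i => ¬ V.u i x = 0), (V.ρ i x + V.ρ' i x).2 =
      ∑ e ∈ (B.N.erase e_q).erase e_p, ((V.ρ e 0).2 + (V.ρ' e 0).2) := by
    rw [← sum_erase ((B.N.erase e_q).filter fun i => ¬ V.u i x = 0) (f := fun i => (V.ρ i x + V.ρ' i x).2) (a := e_p) hterm_p,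
      ← filter_erase, filter_true_of_mem hON]
    refine sum_congr rfl fun e _ => ?_
    rw [Prod.snd_add, (hconst e x 0).1, (hconst e x 0).2]
  rw [PstarCrossCaseP.qDir10_eq I B e_p e_q, ← hV]
  rw [hsum] at h
  have e : ∀ F S t : ZMod 2, F + S = t + 1 → F + t = 1 + S := by decide
  exact e _ _ _ h

/-- **(EQ) case: `q_{(1,0)} + 1 + σ₂` vanishes on `Z(u_{e₁} + 1)`** — where `u_{e₁} = 1` the point lies in the forcing set (`q_m = u_{e₁} = 1` with
`u_p ∨ u_q = 1`, or the corner). -/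
theorem caseT_eq_q10 (hI : I.IsPure xorAndPred) (hT : Typed I) (hD : CrossData I r B e_p e_q g₀) {mv : V2} (hmvT : mv = (0, 1) ∨ mv = (1, 1))
    (hline : ∀ e ∈ (B.N.erase e_q).erase e_p,
      (((sys I B).vsys e_p e_q).ρ e 0 = 0 ∨ ((sys I B).vsys e_p e_q).ρ e 0 = mv) ∧
      (((sys I B).vsys e_p e_q).ρ' e 0 = 0 ∨ ((sys I B).vsys e_p e_q).ρ' e 0 = mv))
    (hread : ∀ e ∈ (B.N.erase e_q).erase e_p, ((sys I B).vsys e_p e_q).ρ e 0 ≠ 0 ∨ ((sys I B).vsys e_p e_q).ρ' e 0 ≠ 0)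
    {e₁ : Fin m} (hq : ∀ x, qDir I B mv x = (sys I B).u e₁ x) {x : Fin n → ZMod 2} (hx : (sys I B).u e₁ x + 1 = 0) :
    qDir I B (1, 0) x + (1 + ∑ e ∈ (B.N.erase e_q).erase e_p, ((((sys I B).vsys e_p e_q).ρ e 0).2 + (((sys I B).vsys e_p e_q).ρ' e 0).2)) = 0 := by
  have hu1 : (sys I B).u e₁ x = 1 := by
    have e : ∀ a : ZMod 2, a + 1 = 0 → a = 1 := by decide
    exact e _ hx
  have hx' : (sys I B).orU e_p e_q x = 0 ∨ qDir I B mv x + (sys I B).orU e_p e_q x = 0 := by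
    have e01 : ∀ t : ZMod 2, t = 0 ∨ t = 1 := by decide
    rcases e01 ((sys I B).orU e_p e_q x) with h | h
    · exact Or.inl h
    · right; rw [hq x, hu1, h]; decide
  rw [caseT_q10 I hI hT hD hmvT hline hread hx']
  exact CharTwo.add_self_eq_zero _

/-! ## The toolkit against `u_{e₀} + 1` -/

/-- `u_{e₀} + 1` satisfies the same polar identity as `u_{e₀}`. -/
theorem u_add_one_add (B : BridgeData n m) (e₀ : Fin m) (x w : Fin n → ZMod 2) :
    (sys I B).u e₀ (x + w) + 1 = ((sys I B).u e₀ x + 1) + ((sys I B).u e₀ w + 1) + ((sys I B).u e₀ 0 + 1) +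
      polar (B.D e₀) (fun j => I.vars j 2) (fun j => I.vars j 3) x w := by
  rw [u_add I B e₀ x w]
  generalize (sys I B).u e₀ x = a; generalize (sys I B).u e₀ w = b; generalize (sys I B).u e₀ 0 = c
  generalize polar (B.D e₀) (fun j => I.vars j 2) (fun j => I.vars j 3) x w = d
  revert a b c d; decide

/-- **Single-quadric classification against `u_{e₀} + 1`**: a quadratic vanishing on `{u_{e₀} = 1}` is `0`, `u_{e₀} + 1`, or a product of two affine
functions up to adding `u_{e₀} + 1`. -/
theorem classification_u_add_one (hI : I.IsPure xorAndPred) (hS : SimpleOverlap I) (hB : BoundaryExpanding r I) (hD : CrossData I r B e_p e_q g₀)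
    {e₀ : Fin m} (he₀ : e₀ ∈ B.N) {g : (Fin n → ZMod 2) → ZMod 2} (hg : IsQuadFn g) (hZ : ∀ x, (sys I B).u e₀ x + 1 = 0 → g x = 0) :
    ((∀ x, g x = 0) ∨ (∀ x, g x = (sys I B).u e₀ x + 1)) ∨
    (∃ μ₁ μ₂ : (Fin n → ZMod 2) → ZMod 2, IsAffineFn μ₁ ∧ IsAffineFn μ₂ ∧
      ((∀ x, g x = μ₁ x * μ₂ x) ∨ (∀ x, ((sys I B).u e₀ x + 1) + g x = μ₁ x * μ₂ x))) := by
  have hrank := rank_four_of_wf I hI hS hB hD.wf (card_J₀_le I hD) he₀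
  have hu := u_add I B e₀
  have hu1 := u_add_one_add I B e₀
  have hnc : ∃ v, (sys I B).u e₀ v + 1 ≠ (sys I B).u e₀ 0 + 1 := by
    obtain ⟨v, hv⟩ := exists_ne_of_rank_four hu hrank
    exact ⟨v, fun h => hv (add_right_cancel h)⟩
  rcases classification hu1 hnc hg hZ with h | h | ⟨a, b, hab, hq, -⟩
  · exact Or.inl h
  · exact Or.inr h
  · exfalso
    set P : LinearMap.BilinForm (ZMod 2) (Fin n → ZMod 2) := polar (B.D e₀) (fun j => I.vars j 2) (fun j => I.vars j 3) with hP
    have hμ : ∀ c : Fin n → ZMod 2, IsAffineFn (fun x => P x c + (((sys I B).u e₀ c + 1) + ((sys I B).u e₀ 0 + 1))) := by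
      intro c x w
      show P (x + w) c + _ = P x c + _ + (P w c + _) + (P 0 c + _)
      rw [P.map_add, LinearMap.add_apply, P.map_zero, LinearMap.zero_apply]
      have e : ∀ p q k : ZMod 2, p + q + k = p + k + (q + k) + (0 + k) := by decide
      exact e _ _ _
    refine not_rank_four_of_mul hu (hμ b) (hμ a) (κ := 0) (fun x => ?_) hrank
    have e : ∀ u p : ZMod 2, u + 1 = p + 1 → u = p + 0 := by decide
    exact e _ _ (hq x)

/-- **Rows against `u_{e₀} + 1` are clean or NON-DEGENERATE products.** -/
theorem clean_or_nondeg_add_one (hI : I.IsPure xorAndPred) (hS : SimpleOverlap I) (hB : BoundaryExpanding r I) (hD : CrossData I r B e_p e_q g₀)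
    {e₀ : Fin m} (he₀ : e₀ ∈ B.N) {g : (Fin n → ZMod 2) → ZMod 2} (hg : IsQuadFn g) (hZ : ∀ x, (sys I B).u e₀ x + 1 = 0 → g x = 0) :
    ((∀ x, g x = 0) ∨ (∀ x, g x = (sys I B).u e₀ x + 1)) ∨
    (∃ μ₁ μ₂ : (Fin n → ZMod 2) → ZMod 2, IsAffineFn μ₁ ∧ IsAffineFn μ₂ ∧
      (∃ z, μ₁ z ≠ μ₁ 0) ∧ (∃ z, μ₂ z ≠ μ₂ 0) ∧ (∃ z, μ₁ z + μ₁ 0 ≠ μ₂ z + μ₂ 0) ∧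
      ((∀ x, g x = μ₁ x * μ₂ x) ∨ (∀ x, ((sys I B).u e₀ x + 1) + g x = μ₁ x * μ₂ x))) := by
  rcases classification_u_add_one I hI hS hB hD he₀ hg hZ with h | ⟨μ₁, μ₂, hμ₁, hμ₂, hrow⟩
  · exact Or.inl h
  · have hu1 := u_add_one_add I B e₀
    have hrank := rank_four_of_wf I hI hS hB hD.wf (card_J₀_le I hD) he₀
    have hPZ : ∀ x, (sys I B).u e₀ x + 1 = 0 → μ₁ x * μ₂ x = 0 := fun x hx => by
      rcases hrow with h | h
      · rw [← h x, hZ x hx]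
      · rw [← h x, hZ x hx, hx, zero_add]
    by_cases hdeg : (∀ z, μ₁ z = μ₁ 0) ∨ (∀ z, μ₂ z = μ₂ 0) ∨ (∀ z, μ₁ z + μ₁ 0 = μ₂ z + μ₂ 0)
    · have h0 := mul_eq_zero_of_degenerate (Q := fun x => (sys I B).u e₀ x + 1) hu1 hrank hμ₁ hμ₂ hdeg hPZ
      left
      rcases hrow with h | h
      · exact Or.inl fun x => by rw [h x, h0 x]
      · refine Or.inr fun x => ?_
        have e : ∀ u a : ZMod 2, u + a = 0 → a = u := by decide
        exact e _ _ (by rw [h x, h0 x])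
    · push Not at hdeg
      obtain ⟨hn₁, hn₂, hn⟩ := hdeg
      exact Or.inr ⟨μ₁, μ₂, hμ₁, hμ₂, hn₁, hn₂, hn, hrow⟩

/-- **The linear parts of a non-degenerate product vanishing on `{u_{e₀} = 1}` live on the AND variables of `D e₀`.** -/
theorem factors_fixed_off_D_add_one (hI : I.IsPure xorAndPred) (hS : SimpleOverlap I) (hB : BoundaryExpanding r I) (hD : CrossData I r B e_p e_q g₀)
    {e₀ : Fin m} (he₀ : e₀ ∈ B.N) {μ₁ μ₂ : (Fin n → ZMod 2) → ZMod 2} (h₁ : IsAffineFn μ₁) (h₂ : IsAffineFn μ₂)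
    (hn₁ : ∃ z, μ₁ z ≠ μ₁ 0) (hn₂ : ∃ z, μ₂ z ≠ μ₂ 0) (hn : ∃ z, μ₁ z + μ₁ 0 ≠ μ₂ z + μ₂ 0)
    (hZ : ∀ x, (sys I B).u e₀ x + 1 = 0 → μ₁ x * μ₂ x = 0) {z : Fin n} (hz : ∀ j ∈ B.D e₀, I.vars j 2 ≠ z ∧ I.vars j 3 ≠ z) :
    μ₁ (Pi.single z 1) = μ₁ 0 ∧ μ₂ (Pi.single z 1) = μ₂ 0 :=
  shift_of_vanish (Q := fun x => (sys I B).u e₀ x + 1) (u_add_one_add I B e₀) (rank_four_of_wf I hI hS hB hD.wf (card_J₀_le I hD) he₀)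
    h₁ h₂ hn₁ hn₂ hn hZ fun x => by show (sys I B).u e₀ (x + Pi.single z 1) + 1 = _; rw [u_add_single_of_unread I B e₀ hz]

end

end Summit.PneNP.PneNP.Theorems.PstarCrossCaseTRows
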